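import Literature.AnabelianGeometry.EtaleTheta.Discharge.Sec1AutPreservesDeltaTemp
import HarnessLib

/-!
# [EtTh] Thm. 1.10 (iii): the input (ΔX) «`γ_X(Δ^tp_{Xα}) = Δ^tp_{Xβ}`» BY NAME from [AbsAnab] Lem. 1.3.8

The X-level closers of Thm. 1.10 (iii) (abc-iut-w5-d062: `thm110iiiGalSect_of_Xlevel` p442622,
`thm110iiiGalSect_of_Xlevel_twoTorsion` p443938) take the input (ΔX)
`(Ker augα).map γ_X = Ker augβ`, i.e. `γ_X(Δ^tp_{Xα}) = Δ^tp_{Xβ}` for the isomorphism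
`γ_X : Π^tp_{Xα} ⥲ Π^tp_{Xβ}` of `Thm110Hypothesis`.  Print ([EtTh] proof of Thm. 1.6, p. 24): «the fact that `γ`
maps `Δ^tp_{Xα}` onto `Δ^tp_{Xβ}` [cf. [Mzk2], Lemma 1.3.8]».  abc-iut-w4-d014's `Sec1AutPreservesDeltaTemp` did
this for AUTOMORPHISMS of one curve; this file does the two-curve case:

* `TemperedCurve.exists_isoCompletionMap` / `exists_isoCompletion` — a continuous homomorphism, indeed an
  isomorphism of topological groups, `γ̂ : Π_{Xα} ⥲ Π_{Xβ}` extending `γ` EXISTS (universal property of the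
  profinite completion `IsProfiniteCompletion.exists_extension`; inverse `(γ⁻¹)^` by uniqueness of extensions);
* `ThetaSetting.map_deltaTemp_eq_of_map_deltaHat_isoCompletion` — `γ̂(Δ_{Xα}) = Δ_{Xβ}` ⇒
  `γ(Δ^tp_{Xα}) = Δ^tp_{Xβ}` (`Π^tp ∩ Δ = Δ^tp`, `comap_toHat_deltaHat`);
* `ThetaSetting.map_deltaTemp_eq_of_preservesGeom_iso` / `map_ker_aug_eq_of_preservesGeom_iso` /
  `map_ker_aug_eq_of_forall_preservesGeom` — (ΔX) FROM FACT-LIST F-0007 `FundamentalExtension.PreservesGeom`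
  ([AbsAnab] Lem. 1.3.8) bound at fundamental extensions modelling `Π_{Xα} ↠ G_{Kα}`, `Π_{Xβ} ↠ G_{Kβ}` and a
  completed isomorphism `γ̂`.  PROOF-ONLY file (0 `def`s).

HONEST FRAMING: [AbsAnab] Lem. 1.3.8 enters BY NAME (a hypothesis), nothing printed is asserted; typed ≠ proved;
no side taken on [IUTchIII] Cor. 3.12, on which nothing here bears.
-/

namespace Literature.AnabelianGeometry.SemiGraphs

namespace TemperedCurve

variable {p : ℕ} [Fact p.Prime] (X Y : TemperedCurve p) (γ : X.PiTemp ≃ₜ* Y.PiTemp)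

/-- Existence of a continuous homomorphism `γ̂ : Π_{Xα} → Π_{Xβ}` with `γ̂ ∘ ι_{Xα} = ι_{Xβ} ∘ γ` (universal
property of the profinite completion). [cite: MochizukiSemiAnbd2006, §6 p.69] -/
theorem exists_isoCompletionMap :
    ∃ Φ : X.PiHat →ₜ* Y.PiHat, ∀ x : X.PiTemp, Φ (X.toHat x) = Y.toHat (γ x) := by
  haveI : CompactSpace Y.PiHat := Y.isProfiniteCompletion_toHat.compactSpace
  haveI : TotallyDisconnectedSpace Y.PiHat := Y.isProfiniteCompletion_toHat.totallyDisconnectedSpace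
  obtain ⟨Φ, hΦ⟩ := IsProfiniteCompletion.exists_extension X.isProfiniteCompletion_toHat
    (Y.toHat.comp { toMonoidHom := γ.toMulEquiv.toMonoidHom, continuous_toFun := γ.continuous })
  exact ⟨Φ, fun x => hΦ x⟩

/-- Two continuous homomorphisms `Π_{Xα} → P` (`P` Hausdorff) agreeing on `ι(Π^tp_{Xα})` are equal.
[cite: MochizukiSemiAnbd2006, §6 p.69] -/
theorem completion_ext {P : Type*} [Group P] [TopologicalSpace P] [T2Space P] (Φ Ψ : X.PiHat →ₜ* P)
    (h : ∀ x : X.PiTemp, Φ (X.toHat x) = Ψ (X.toHat x)) : Φ = Ψ :=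
  IsProfiniteCompletion.extension_unique X.isProfiniteCompletion_toHat Φ Ψ h

/-- **The completed isomorphism `γ̂ : Π_{Xα} ⥲ Π_{Xβ}` EXISTS**: an isomorphism of topological groups with
`γ̂ ∘ ι_{Xα} = ι_{Xβ} ∘ γ` (extensions of `γ` and `γ⁻¹`, mutually inverse by uniqueness of extensions).
[cite: MochizukiSemiAnbd2006, §6 p.69] -/
theorem exists_isoCompletion :
    ∃ Φ : X.PiHat ≃ₜ* Y.PiHat, ∀ x : X.PiTemp, Φ (X.toHat x) = Y.toHat (γ x) := by
  haveI : T2Space X.PiHat := X.isProfiniteCompletion_toHat.t2Space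
  haveI : T2Space Y.PiHat := Y.isProfiniteCompletion_toHat.t2Space
  obtain ⟨Φ, hΦ⟩ := X.exists_isoCompletionMap Y γ
  obtain ⟨Ψ, hΨ⟩ := Y.exists_isoCompletionMap X γ.symm
  have h1 : Φ.comp Ψ = ContinuousMonoidHom.id Y.PiHat := by
    refine Y.completion_ext _ _ fun y => ?_
    change Φ (Ψ (Y.toHat y)) = Y.toHat y
    rw [hΨ, hΦ, ContinuousMulEquiv.apply_symm_apply]
  have h2 : Ψ.comp Φ = ContinuousMonoidHom.id X.PiHat := by
    refine X.completion_ext _ _ fun x => ?_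
    change Ψ (Φ (X.toHat x)) = X.toHat x
    rw [hΦ, hΨ, ContinuousMulEquiv.symm_apply_apply]
  let e : X.PiHat ≃* Y.PiHat := MonoidHom.toMulEquiv Φ.toMonoidHom Ψ.toMonoidHom
    (MonoidHom.ext fun z => DFunLike.congr_fun h2 z) (MonoidHom.ext fun z => DFunLike.congr_fun h1 z)
  exact ⟨{ toMulEquiv := e, continuous_toFun := Φ.continuous, continuous_invFun := Ψ.continuous }, hΦ⟩

end TemperedCurve

end Literature.AnabelianGeometry.SemiGraphs

namespace Literature.AnabelianGeometry.EtaleTheta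

namespace ThetaSetting

open Literature.AnabelianGeometry.SemiGraphs Literature.AnabelianGeometry.AbsoluteAnabelian

variable {p : ℕ} [Fact p.Prime] (Dα Dβ : ThetaSetting p) (γ : Dα.PiTemp ≃ₜ* Dβ.PiTemp)

/-- **Tempered form from the profinite form**: if a completed isomorphism `γ̂` (`γ̂ ∘ ι = ι ∘ γ`; one EXISTS,
`TemperedCurve.exists_isoCompletion`) maps `Δ_{Xα}` onto `Δ_{Xβ}`, then `γ` maps `Δ^tp_{Xα}` onto `Δ^tp_{Xβ}`
(`Π^tp ∩ Δ = Δ^tp`: `comap_toHat_deltaHat`). [cite: MochizukiEtTh2009, Thm 1.6 (i) p.24] -/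
theorem map_deltaTemp_eq_of_map_deltaHat_isoCompletion (Φ : Dα.PiHat ≃ₜ* Dβ.PiHat)
    (hΦ : ∀ x : Dα.PiTemp, Φ (Dα.toHat x) = Dβ.toHat (γ x))
    (hΔhat : Dα.DeltaHat.map Φ.toMulEquiv.toMonoidHom = Dβ.DeltaHat) :
    Dα.DeltaTemp.map γ.toMulEquiv.toMonoidHom = Dβ.DeltaTemp := by
  have hiff : ∀ x : Dα.PiTemp, x ∈ Dα.DeltaTemp ↔ γ x ∈ Dβ.DeltaTemp := fun x => by
    rw [← Dα.comap_toHat_deltaHat, ← Dβ.comap_toHat_deltaHat, Subgroup.mem_comap, Subgroup.mem_comap]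
    change Dα.toHat x ∈ Dα.DeltaHat ↔ Dβ.toHat (γ x) ∈ Dβ.DeltaHat
    rw [← hΦ x, ← hΔhat]
    constructor
    · intro hx
      exact ⟨Dα.toHat x, hx, rfl⟩
    · rintro ⟨y, hy, hyx⟩
      have : y = Dα.toHat x := Φ.injective hyx
      rwa [this] at hy
  ext y
  constructor
  · rintro ⟨x, hx, rfl⟩
    exact (hiff x).1 hx
  · intro hy
    refine ⟨γ.symm y, (hiff _).2 ?_, γ.apply_symm_apply y⟩
    rwa [γ.apply_symm_apply]

/-- **(ΔX) BY NAME from F-0007** ([AbsAnab] Lem. 1.3.8 «`Δ ⊆ Π` is group-theoretic», the citation of [EtTh]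
p. 24): bind `FundamentalExtension.PreservesGeom` at fundamental extensions `(Eα, eα)`, `(Eβ, eβ)` modelling
`Π_{Xα} ↠ G_{Kα}`, `Π_{Xβ} ↠ G_{Kβ}` and at a completed isomorphism `γ̂`; then `γ(Δ^tp_{Xα}) = Δ^tp_{Xβ}`.
[cite: MochizukiEtTh2009, Thm 1.6 (i) p.24] -/
theorem map_deltaTemp_eq_of_preservesGeom_iso (Φ : Dα.PiHat ≃ₜ* Dβ.PiHat)
    (hΦ : ∀ x : Dα.PiTemp, Φ (Dα.toHat x) = Dβ.toHat (γ x)) (Eα Eβ : FundamentalExtension.{0})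
    (eα : Eα.arith ≃ₜ* Dα.PiHat) (eβ : Eβ.arith ≃ₜ* Dβ.PiHat)
    (heα : Eα.geom.map eα.toMulEquiv.toMonoidHom = Dα.DeltaHat)
    (heβ : Eβ.geom.map eβ.toMulEquiv.toMonoidHom = Dβ.DeltaHat)
    (h138 : FundamentalExtension.PreservesGeom (F := Eβ) (eα.trans (Φ.trans eβ.symm))) :
    Dα.DeltaTemp.map γ.toMulEquiv.toMonoidHom = Dβ.DeltaTemp := by
  apply Dα.map_deltaTemp_eq_of_map_deltaHat_isoCompletion Dβ γ Φ hΦ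
  have h := congrArg (Subgroup.map eβ.toMulEquiv.toMonoidHom) h138
  rw [heβ, Subgroup.map_map] at h
  have hcomp : eβ.toMulEquiv.toMonoidHom.comp (eα.trans (Φ.trans eβ.symm)).toMulEquiv.toMonoidHom =
      Φ.toMulEquiv.toMonoidHom.comp eα.toMulEquiv.toMonoidHom := by
    ext x
    change eβ (eβ.symm (Φ (eα x))) = Φ (eα x)
    rw [ContinuousMulEquiv.apply_symm_apply]
  rw [hcomp, ← Subgroup.map_map, heα] at h
  exact h

/-- (ΔX) in the X-level closers' spelling `(Ker aug).map γ = Ker aug` (`Δ^tp_X := Ker aug`).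
[cite: MochizukiEtTh2009, Thm 1.6 (i) p.24] -/
theorem map_ker_aug_eq_of_preservesGeom_iso (Φ : Dα.PiHat ≃ₜ* Dβ.PiHat)
    (hΦ : ∀ x : Dα.PiTemp, Φ (Dα.toHat x) = Dβ.toHat (γ x)) (Eα Eβ : FundamentalExtension.{0})
    (eα : Eα.arith ≃ₜ* Dα.PiHat) (eβ : Eβ.arith ≃ₜ* Dβ.PiHat)
    (heα : Eα.geom.map eα.toMulEquiv.toMonoidHom = Dα.DeltaHat)
    (heβ : Eβ.geom.map eβ.toMulEquiv.toMonoidHom = Dβ.DeltaHat)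
    (h138 : FundamentalExtension.PreservesGeom (F := Eβ) (eα.trans (Φ.trans eβ.symm))) :
    (Dα.aug.toMonoidHom.ker).map γ.toMulEquiv.toMonoidHom = Dβ.aug.toMonoidHom.ker :=
  Dα.map_deltaTemp_eq_of_preservesGeom_iso Dβ γ Φ hΦ Eα Eβ eα eβ heα heβ h138

/-- **(ΔX) from [AbsAnab] Lem. 1.3.8 quantified over the completed isomorphism**: if `PreservesGeom` holds for
EVERY identification of `Π_{Xβ}`-side built from a completed isomorphism (the by-name form a consumer states
once), then `γ(Δ^tp_{Xα}) = Δ^tp_{Xβ}` — the completed isomorphism it needs EXISTS. [cite: MochizukiEtTh2009, Thm 1.6 (i) p.24] -/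
theorem map_ker_aug_eq_of_forall_preservesGeom (Eα Eβ : FundamentalExtension.{0})
    (eα : Eα.arith ≃ₜ* Dα.PiHat) (eβ : Eβ.arith ≃ₜ* Dβ.PiHat)
    (heα : Eα.geom.map eα.toMulEquiv.toMonoidHom = Dα.DeltaHat)
    (heβ : Eβ.geom.map eβ.toMulEquiv.toMonoidHom = Dβ.DeltaHat)
    (h138 : ∀ Φ : Dα.PiHat ≃ₜ* Dβ.PiHat, (∀ x : Dα.PiTemp, Φ (Dα.toHat x) = Dβ.toHat (γ x)) →
      FundamentalExtension.PreservesGeom (F := Eβ) (eα.trans (Φ.trans eβ.symm))) :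
    (Dα.aug.toMonoidHom.ker).map γ.toMulEquiv.toMonoidHom = Dβ.aug.toMonoidHom.ker := by
  obtain ⟨Φ, hΦ⟩ := Dα.toTemperedCurve.exists_isoCompletion Dβ.toTemperedCurve γ
  exact Dα.map_ker_aug_eq_of_preservesGeom_iso Dβ γ Φ hΦ Eα Eβ eα eβ heα heβ (h138 Φ hΦ)

end ThetaSetting

end Literature.AnabelianGeometry.EtaleTheta
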